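import Literature.AlgebraicGeometry.AbelianSchemes.AbelianSchemeOverZariskiGluingHom
import Literature.AlgebraicGeometry.AbelianSchemes.AbelianSchemeOverZariskiGluingLevel
import Literature.AlgebraicGeometry.AbelianSchemes.IsLambdaOfAtOfIsBaseChangeVia
import Literature.AlgebraicGeometry.AbelianSchemes.AbelianSchemeDualTransport
import HarnessLib

/-!
# Gluing POLARISATIONS along a Zariski gluing datum of abelian schemes

Layer `Literature/AlgebraicGeometry/AbelianSchemes`, namespace
`Literature.AlgebraicGeometry.AbelianSchemes.AbelianSchemeOver.ZariskiGluingDatum`.  Cell `hodgecm-mathlib` (D-0151),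
(h7) «Zariski gluing of `S`-objects from a cocycle», the POLARISATION layer (P1) over FILE 3b
(`ZariskiGluingDatum.abelianScheme`: the abelian scheme `Z/S` glued from charts `Aᵢ/Uᵢ`) and FILE 8b
(`ZariskiGluingDatum.glueHom`: homomorphisms out of `Z` from compatible chartwise ones); count-neutral Literature
capital.  HC_CM is proved only modulo the 7 printed citations until rung 0 closes.

Fix a Zariski gluing datum `𝔇` over `S` with glued abelian scheme `Z = 𝔇.abelianScheme` and a dual pair
`D₀ = (Ẑ, 𝒫₀)` OF THE GLUED SCHEME (given — road (D-F3) of the cell: the dual of `Z` comes from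
[MumfordFogartyKirwan1994, Ch. 6 §1 Cor. 6.8], not from gluing).  A **`PolarizationDatum 𝔇 D₀`** is, on every chart,
a dual pair `Dᵢ = (Âᵢ, 𝒫ᵢ)` of `Aᵢ`, a polarisation `λᵢ : Aᵢ → Âᵢ` ([MumfordFogartyKirwan1994, Def. 6.3]), and a
cartesian chart of duals `Ĝᵢ : Âᵢ → Ẑ` over `Uᵢ → S` (a base change of group schemes, `IsBaseChangeVia`) carrying
the POINCARÉ CLAUSE `(χᵢ ×_{Uᵢ→S} Ĝᵢ)^*𝒫₀ ≅ 𝒫ᵢ` of [MumfordFogartyKirwan1994, Def. 7.2], such that the maps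
`λᵢ ≫ Ĝᵢ : Aᵢ → Ẑ` agree on the overlaps `A₂ i j = Aᵢ ×_Z Aⱼ`.

* §1 `hatChart`, `lamChart` — `λᵢ ≫ Ĝᵢ` read as a `Uᵢ`-HOMOMORPHISM `Aᵢ → Ẑ ×_S Uᵢ` (`isMonHom_lamChart`: `Ĝᵢ`
  induces an isomorphism of `Uᵢ`-group schemes `Âᵢ ≅ Ẑ ×_S Uᵢ`, ★ `isBaseChangeVia_id_of_comp_eq`).
* §2 **`glueLam : Z → Ẑ`** — the glued `S`-homomorphism (FILE 8b `glueHom`, `isMonHom_glueHom`), with its chart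
  clause `χᵢ ≫ glueLam = λᵢ ≫ Ĝᵢ` (`χ_glueLam_left`) = the `λ`-clause of [MumfordFogartyKirwan1994, Def. 7.2] for the
  chart square, and uniqueness (`eq_glueLam`).
* §3 **`exists_ample_glueLam`** — at every geometric point `s` of `S`, `glueLam‾ = Λ(𝒪(Θ))` for an ample `Θ`:
  `s` factors through some `Uᵢ` (FILE 4 `exists_fac`), and the fibrewise clause of `λᵢ` at `s′` TRANSPORTS along the
  cartesian chart square `(χᵢ, Ĝᵢ)` with its Poincaré clause (★ `transfer_of_isBaseChangeVia_fibreIso`,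
  [MumfordFogartyKirwan1994, Def. 6.2–6.3; Lan2013, Lemma 1.3.6.6]) through the fibre isomorphism
  `(Aᵢ)_{s′} ≅ Z_{s′ ≫ (Uᵢ → S)}` of the chart (`fibreChartIso`).
* §4 **`polarization : Z.Polarization D₀`** — the glued polarisation ([MumfordFogartyKirwan1994, Def. 6.3]: a
  homomorphism `λ` with `λ̄_s = Λ(ample)` at all geometric points — both clauses are local on `S`).

## References
* [MumfordFogartyKirwan1994] D. Mumford, J. Fogarty, F. Kirwan, *Geometric Invariant Theory* (3rd ed., 1994), Ch. 6 §2
  Definition 6.2–6.3 (p. 120); Ch. 7 §2 Definition 7.2 (p. 129).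
* [GortzWedhorn2020] U. Görtz, T. Wedhorn, *Algebraic Geometry I* (2nd ed., 2020), Section (3.3) Proposition 3.5;
  Section (4.15) (p. 116).
* [Lan2013PELCompactifications] K.-W. Lan, *Arithmetic compactifications of PEL-type Shimura varieties* (2013), §1.3.6
  Lemma 1.3.6.6 (pp. 81–82).
-/

noncomputable section

universe u

open CategoryTheory CategoryTheory.Limits AlgebraicGeometry MonoidalCategory CartesianMonoidalCategory
open scoped MonObj

namespace Literature.AlgebraicGeometry.AbelianSchemes

namespace AbelianSchemeOver

namespace ZariskiGluingDatum

open Literature.AlgebraicGeometry.Motives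

variable {S : Scheme.{u}} {𝔇 : ZariskiGluingDatum S} {D₀ : 𝔇.abelianScheme.DualPair}

variable (𝔇 D₀) in
/-- **Chartwise polarisation data for a Zariski gluing datum `𝔇` and a dual pair `D₀ = (Ẑ, 𝒫₀)` of the glued abelian
scheme `Z`**: on every chart `Uᵢ` a dual pair `Dᵢ = (Âᵢ, 𝒫ᵢ)` of `Aᵢ`, a polarisation `λᵢ : Aᵢ → Âᵢ`
([MumfordFogartyKirwan1994, Def. 6.3]), a cartesian chart of duals `Ĝᵢ : Âᵢ → Ẑ` over `Uᵢ → S` compatible with the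
group laws, the POINCARÉ CLAUSE `(χᵢ ×_S Ĝᵢ)^*𝒫₀ ≅ 𝒫ᵢ` of [MumfordFogartyKirwan1994, Def. 7.2] (stated exactly as
in ★ `PolarizedAbelianSchemeWithLevel.IsBaseChangeVia`), and agreement of the `λᵢ ≫ Ĝᵢ` on the overlaps
`A₂ i j = Aᵢ ×_Z Aⱼ`. [cite: MumfordFogartyKirwan1994, Ch. 7 §2 Definition 7.2 (p. 129)]
[cite: MumfordFogartyKirwan1994, Ch. 6 §2 Definition 6.3 (p. 120)] -/
structure PolarizationDatum where
  /-- the dual pair `(Âᵢ, 𝒫ᵢ)` of the chart `Aᵢ/Uᵢ` -/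
  Dc : ∀ i, (𝔇.A i).DualPair
  /-- the polarisation `λᵢ : Aᵢ → Âᵢ` of the chart -/
  pol : ∀ i, (𝔇.A i).Polarization (Dc i)
  /-- the chart of duals `Ĝᵢ : Âᵢ → Ẑ` -/
  Ĝ : ∀ i, (Dc i).hat.X.left ⟶ D₀.hat.X.left
  /-- `Ĝᵢ` exhibits `Âᵢ` as the base change of `Ẑ` along `Uᵢ → S` as group schemes -/
  hĜ : ∀ i, (Dc i).hat.IsBaseChangeVia D₀.hat (𝔇.𝒰.f i) (Ĝ i)
  /-- the Poincaré clause `(χᵢ ×_S Ĝᵢ)^*𝒫₀ ≅ 𝒫ᵢ` -/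
  poincare : ∀ i, ∃ (wG : (𝔇.A i).X.hom ≫ 𝔇.𝒰.f i = 𝔇.χ i ≫ 𝔇.abelianScheme.X.hom)
    (wĜ : (Dc i).hat.X.hom ≫ 𝔇.𝒰.f i = Ĝ i ≫ D₀.hat.X.hom),
    Nonempty ((Scheme.Modules.pullback (pullback.map (𝔇.A i).X.hom (Dc i).hat.X.hom 𝔇.abelianScheme.X.hom
      D₀.hat.X.hom (𝔇.χ i) (Ĝ i) (𝔇.𝒰.f i) wG wĜ)).obj D₀.P ≅ (Dc i).P)
  /-- the `λᵢ ≫ Ĝᵢ : Aᵢ → Ẑ` agree on the overlaps `A₂ i j` -/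
  compat : ∀ i j, 𝔇.κ₁ i j ≫ (pol i).lam.left ≫ Ĝ i = 𝔇.κ₂ i j ≫ (pol j).lam.left ≫ Ĝ j

/-! ### §0 The fibres of the charts are fibres of the glued scheme -/

variable (𝔇) in
/-- **The fibre of the chart `Aᵢ` at `s′` is the fibre of `Z` at `s′ ≫ (Uᵢ → S)`**, as abelian varieties: through the
isomorphism of `Uᵢ`-group schemes `Aᵢ ≅ Z ×_S Uᵢ` (FILE 8b `chartIso`, ★ `fibreIsoOfIso`) and ★ `fibreBaseChangeIso`.
[cite: GortzWedhorn2020, Section (4.7) (pp. 107–108)] -/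
def fibreChartIso (i : 𝔇.𝒰.I₀) {Ω : Type u} [Field Ω] (s' : Spec (.of Ω) ⟶ 𝔇.𝒰.X i) :
    ((𝔇.A i).fibre s').toAbelianVariety ≅ (𝔇.abelianScheme.fibre (s' ≫ 𝔇.𝒰.f i)).toAbelianVariety :=
  haveI := 𝔇.isMonHom_chartIso_hom i
  fibreIsoOfIso (𝔇.chartIso i) s' ≪≫ 𝔇.abelianScheme.fibreBaseChangeIso (𝔇.𝒰.f i) s'

variable (𝔇) in
/-- `fibreChartIso` lies over the chart map `χᵢ : Aᵢ → Z` (the `he` clause of ★ `transfer_of_isBaseChangeVia_fibreIso`).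
[cite: GortzWedhorn2020, Section (4.7) (pp. 107–108)] -/
theorem fibreChartIso_hom_fst (i : 𝔇.𝒰.I₀) {Ω : Type u} [Field Ω] (s' : Spec (.of Ω) ⟶ 𝔇.𝒰.X i) :
    AbelianVariety.Hom.toSchemeHom (𝔇.fibreChartIso i s').hom ≫
        pullback.fst 𝔇.abelianScheme.X.hom (s' ≫ 𝔇.𝒰.f i) =
      pullback.fst (𝔇.A i).X.hom s' ≫ 𝔇.χ i := by
  haveI := 𝔇.isMonHom_chartIso_hom i
  have h1 := fibreIsoOfIso_hom_toSchemeHom_fst (𝔇.chartIso i) s'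
  have h2 := 𝔇.abelianScheme.fibreBaseChangeIso_hom_toSchemeHom_fst (𝔇.𝒰.f i) s'
  have h3 : (𝔇.chartIso i).hom.left ≫ pullback.fst 𝔇.abelianScheme.X.hom (𝔇.𝒰.f i) = 𝔇.χ i :=
    (𝔇.hχ i).isoPullback_hom_fst
  exact (Category.assoc (AbelianVariety.Hom.toSchemeHom (fibreIsoOfIso (𝔇.chartIso i) s').hom)
    (AbelianVariety.Hom.toSchemeHom (𝔇.abelianScheme.fibreBaseChangeIso (𝔇.𝒰.f i) s').hom) _).trans <|
    (congrArg (AbelianVariety.Hom.toSchemeHom (fibreIsoOfIso (𝔇.chartIso i) s').hom ≫ ·) h2).trans <|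
    (Category.assoc _ _ _).symm.trans <|
    (congrArg (· ≫ pullback.fst 𝔇.abelianScheme.X.hom (𝔇.𝒰.f i)) h1).trans <|
    (Category.assoc _ _ _).trans (congrArg (pullback.fst (𝔇.A i).X.hom s' ≫ ·) h3)

namespace PolarizationDatum

variable (𝔓 : PolarizationDatum 𝔇 D₀)

/-! ### §1 The chart homomorphisms `λᵢ ≫ Ĝᵢ : Aᵢ → Ẑ ×_S Uᵢ` -/

/-- `Ĝᵢ` lies over `Uᵢ → S`. [cite: MumfordFogartyKirwan1994, Ch. 7 §2 Definition 7.2 (p. 129)] -/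
@[reassoc]
theorem Ĝ_comp_hom (i : 𝔇.𝒰.I₀) : 𝔓.Ĝ i ≫ D₀.hat.X.hom = (𝔓.Dc i).hat.X.hom ≫ 𝔇.𝒰.f i :=
  (𝔓.hĜ i).fst

/-- The comparison `Âᵢ → Ẑ ×_S Uᵢ` of `Uᵢ`-schemes induced by `Ĝᵢ`. [cite: MumfordFogartyKirwan1994, Ch. 7 §2 Definition 7.2 (p. 129)] -/
def hatChart (i : 𝔇.𝒰.I₀) : (𝔓.Dc i).hat.X ⟶ (D₀.hat.baseChange (𝔇.𝒰.f i)).X :=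
  Over.homMk (pullback.lift (𝔓.Ĝ i) (𝔓.Dc i).hat.X.hom (𝔓.Ĝ_comp_hom i)) (pullback.lift_snd _ _ _)

/-- The underlying morphism of `hatChart`. [cite: MumfordFogartyKirwan1994, Ch. 7 §2 Definition 7.2 (p. 129)] -/
theorem hatChart_left (i : 𝔇.𝒰.I₀) :
    (𝔓.hatChart i).left = pullback.lift (𝔓.Ĝ i) (𝔓.Dc i).hat.X.hom (𝔓.Ĝ_comp_hom i) :=
  rfl

/-- `hatChart` is an isomorphism (both `Âᵢ` and `Ẑ ×_S Uᵢ` are cartesian over `Ẑ`). [cite: GortzWedhorn2020, Section (4.8) Lemma 4.28] -/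
theorem isIso_hatChart_left (i : 𝔇.𝒰.I₀) : IsIso (𝔓.hatChart i).left := by
  have e : (𝔓.hatChart i).left = (𝔓.hĜ i).snd.1.isoPullback.hom := by
    rw [hatChart_left]
    apply pullback.hom_ext
    · rw [pullback.lift_fst, IsPullback.isoPullback_hom_fst]
    · rw [pullback.lift_snd, IsPullback.isoPullback_hom_snd]
  rw [e]
  infer_instance

/-- **`hatChart` is an isomorphism of `Uᵢ`-GROUP schemes**: `Âᵢ` (via `Ĝᵢ`) and `Ẑ ×_S Uᵢ` (★
`baseChange_isBaseChangeVia`) are both base changes of `Ẑ` along `Uᵢ → S`, hence related along `𝟙` (★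
`isBaseChangeVia_id_of_comp_eq`, FILE 8b `isMonHom_of_isBaseChangeVia_id`).
[cite: MumfordFogartyKirwan1994, Ch. 7 §2 Definition 7.2 (p. 129)] [cite: GortzWedhorn2020, Section (4.15) (p. 116) and Definition 4.42 (p. 116)] -/
theorem isMonHom_hatChart (i : 𝔇.𝒰.I₀) : IsMonHom (𝔓.hatChart i) :=
  haveI := 𝔓.isIso_hatChart_left i
  isMonHom_of_isBaseChangeVia_id _ (isBaseChangeVia_id_of_comp_eq (D₀.hat.baseChange_isBaseChangeVia (𝔇.𝒰.f i))
    (𝔓.hĜ i) (𝔓.hatChart i).left (pullback.lift_fst _ _ _) (pullback.lift_snd _ _ _))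

/-- **The chart homomorphism `λᵢ ≫ Ĝᵢ`, read as a `Uᵢ`-morphism `Aᵢ → Ẑ ×_S Uᵢ`** (the input of FILE 8b `glueHom`).
[cite: MumfordFogartyKirwan1994, Ch. 6 §2 Definition 6.3 (p. 120)] [cite: MumfordFogartyKirwan1994, Ch. 7 §2 Definition 7.2 (p. 129)] -/
def lamChart (i : 𝔇.𝒰.I₀) : (𝔇.A i).X ⟶ (D₀.hat.baseChange (𝔇.𝒰.f i)).X :=
  (𝔓.pol i).lam ≫ 𝔓.hatChart i

/-- `lamChart` followed by the projection to `Ẑ` is `λᵢ ≫ Ĝᵢ`. [cite: MumfordFogartyKirwan1994, Ch. 7 §2 Definition 7.2 (p. 129)] -/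
@[reassoc]
theorem lamChart_left_comp_fst (i : 𝔇.𝒰.I₀) :
    (𝔓.lamChart i).left ≫ pullback.fst D₀.hat.X.hom (𝔇.𝒰.f i) = (𝔓.pol i).lam.left ≫ 𝔓.Ĝ i := by
  rw [lamChart, Over.comp_left, Category.assoc, hatChart_left]
  erw [pullback.lift_fst]

/-- `lamChart` is a homomorphism of `Uᵢ`-group schemes. [cite: MumfordFogartyKirwan1994, Ch. 6 §2 Definition 6.3 (p. 120)] -/
theorem isMonHom_lamChart (i : 𝔇.𝒰.I₀) : IsMonHom (𝔓.lamChart i) := by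
  haveI := (𝔓.pol i).isMonHom
  haveI := 𝔓.isMonHom_hatChart i
  rw [lamChart]
  infer_instance

/-- The `lamChart` are compatible on the overlaps (the `hlam` input of FILE 8b `glueHom`).
[cite: GortzWedhorn2020, Section (3.3) Proposition 3.5] -/
theorem lamChart_compat (i j : 𝔇.𝒰.I₀) :
    𝔇.κ₁ i j ≫ (𝔓.lamChart i).left ≫ pullback.fst D₀.hat.X.hom (𝔇.𝒰.f i) =
      𝔇.κ₂ i j ≫ (𝔓.lamChart j).left ≫ pullback.fst D₀.hat.X.hom (𝔇.𝒰.f j) := by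
  rw [lamChart_left_comp_fst, lamChart_left_comp_fst]
  exact 𝔓.compat i j

/-! ### §2 The glued homomorphism `λ : Z → Ẑ` -/

/-- **The glued `S`-morphism `λ : Z → Ẑ`** (FILE 8b `glueHom` of the `λᵢ ≫ Ĝᵢ`).
[cite: GortzWedhorn2020, Section (3.3) Proposition 3.5] [cite: MumfordFogartyKirwan1994, Ch. 6 §2 Definition 6.3 (p. 120)] -/
def glueLam : 𝔇.abelianScheme.X ⟶ D₀.hat.X :=
  𝔇.glueHom D₀.hat 𝔓.lamChart 𝔓.lamChart_compat

/-- **The chart clause `χᵢ ≫ λ = λᵢ ≫ Ĝᵢ`** (the `λ`-clause of [MumfordFogartyKirwan1994, Def. 7.2] for the chart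
square `(χᵢ, Ĝᵢ)`). [cite: MumfordFogartyKirwan1994, Ch. 7 §2 Definition 7.2 (p. 129)] [cite: GortzWedhorn2020, Section (3.3) Proposition 3.5] -/
@[reassoc]
theorem χ_glueLam_left (i : 𝔇.𝒰.I₀) : 𝔇.χ i ≫ 𝔓.glueLam.left = (𝔓.pol i).lam.left ≫ 𝔓.Ĝ i := by
  rw [glueLam, χ_glueHom, lamChart_left_comp_fst]

/-- **`λ` is a homomorphism of `S`-group schemes** (FILE 8b `isMonHom_glueHom`: `IsMonHom` is Zariski-local on the
base). [cite: GortzWedhorn2020, Section (4.15) (p. 116) and Definition 4.42 (p. 116)] [cite: MumfordFogartyKirwan1994, Ch. 6 §2 Definition 6.3 (p. 120)] -/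
theorem isMonHom_glueLam : IsMonHom 𝔓.glueLam :=
  𝔇.isMonHom_glueHom D₀.hat 𝔓.lamChart 𝔓.lamChart_compat 𝔓.isMonHom_lamChart

/-- **Uniqueness**: an `S`-morphism `Z → Ẑ` with the chart clauses `χᵢ ≫ λ' = λᵢ ≫ Ĝᵢ` is `glueLam` (the charts
cover `Z`, FILE 8b `hom_ext_out`). [cite: GortzWedhorn2020, Section (3.3) Proposition 3.5] -/
theorem eq_glueLam (lam' : 𝔇.abelianScheme.X ⟶ D₀.hat.X)
    (h : ∀ i, 𝔇.χ i ≫ lam'.left = (𝔓.pol i).lam.left ≫ 𝔓.Ĝ i) : lam' = 𝔓.glueLam := by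
  ext
  exact 𝔇.hom_ext_out _ _ fun i => by rw [h, χ_glueLam_left]

/-! ### §3 The fibrewise clause `λ̄_s = Λ(𝒪(Θ))`, `Θ` ample, transported from the charts -/

/-- **At every geometric point `s` of `S`, `λ̄_s = Λ(𝒪(Θ))` for an AMPLE `Θ` on `Z_s`**: `s = s′ ≫ (Uᵢ → S)` for some
chart (FILE 4 `exists_fac`); an ample `Θ′` with `λ̄ᵢ = Λ(𝒪(Θ′))` at `s′` ([MumfordFogartyKirwan1994, Def. 6.3] for
`λᵢ`) transports along the cartesian chart square `(χᵢ, Ĝᵢ)` with its Poincaré clause and `λ`-clause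
`λᵢ ≫ Ĝᵢ = χᵢ ≫ λ` (★ `transfer_of_isBaseChangeVia_fibreIso`) through `fibreChartIso`.
[cite: MumfordFogartyKirwan1994, Ch. 6 §2 Definition 6.2–6.3 (p. 120)] [cite: Lan2013PELCompactifications, §1.3.6 Lemma 1.3.6.6 (pp. 81–82)] -/
theorem exists_ample_glueLam (Ω : Type u) [Field Ω] [IsAlgClosed Ω] (s : Spec (.of Ω) ⟶ S) :
    ∃ Θ : CartierDivisor (𝔇.abelianScheme.fibre s).toAbelianVariety.X.left,
      Θ.IsAmple ∧ 𝔇.abelianScheme.IsLambdaOfAt s D₀ 𝔓.glueLam Θ := by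
  obtain ⟨i, s', rfl⟩ := 𝔇.exists_fac s
  obtain ⟨Θ', hΘ', h'⟩ := (𝔓.pol i).exists_ample Ω s'
  obtain ⟨wG, wĜ, ⟨eP⟩⟩ := 𝔓.poincare i
  exact ⟨_, transfer_of_isBaseChangeVia_fibreIso 𝔇.abelianScheme D₀ 𝔓.glueLam (𝔇.A i) (𝔓.Dc i) (𝔓.pol i).lam
    (𝔇.𝒰.f i) (𝔇.χ i) (𝔓.Ĝ i) wG wĜ (𝔓.χ_glueLam_left i).symm s' (𝔇.fibreChartIso i s')
    (𝔇.fibreChartIso_hom_fst i s') eP Θ' hΘ' h'⟩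

/-! ### §4 The glued polarisation -/

/-- **The glued POLARISATION `λ : Z → Ẑ` of the glued abelian scheme** with respect to the given dual pair `D₀`:
chartwise polarisations whose `λᵢ ≫ Ĝᵢ` agree on overlaps glue to a polarisation — both clauses of
[MumfordFogartyKirwan1994, Def. 6.3] (homomorphism; `λ̄_s = Λ(ample)` at geometric points) are local on `S`.
[cite: MumfordFogartyKirwan1994, Ch. 6 §2 Definition 6.3 (p. 120)] [cite: MumfordFogartyKirwan1994, Ch. 7 §2 Definition 7.2 (p. 129)] -/
def polarization : 𝔇.abelianScheme.Polarization D₀ where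
  lam := 𝔓.glueLam
  isMonHom := 𝔓.isMonHom_glueLam
  exists_ample := 𝔓.exists_ample_glueLam

/-- The `λ` of the glued polarisation is `glueLam` (definitional). [cite: MumfordFogartyKirwan1994, Ch. 6 §2 Definition 6.3 (p. 120)] -/
theorem polarization_lam : 𝔓.polarization.lam = 𝔓.glueLam := rfl

/-- **The chart clause of the glued polarisation**: `λᵢ ≫ Ĝᵢ = χᵢ ≫ λ` — the `λ`-clause of
★ `PolarizedAbelianSchemeWithLevel.IsBaseChangeVia` for the chart square `(χᵢ, Ĝᵢ)` over `Uᵢ → S`.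
[cite: MumfordFogartyKirwan1994, Ch. 7 §2 Definition 7.2 (p. 129)] -/
theorem pol_lam_left_comp_Ĝ (i : 𝔇.𝒰.I₀) :
    (𝔓.pol i).lam.left ≫ 𝔓.Ĝ i = 𝔇.χ i ≫ 𝔓.polarization.lam.left :=
  (𝔓.χ_glueLam_left i).symm

end PolarizationDatum

end ZariskiGluingDatum

end AbelianSchemeOver

end Literature.AlgebraicGeometry.AbelianSchemes

end
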